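import Literature.AnabelianGeometry.EtaleTheta.Discharge.Sec2Cor219iiiHeartPrelims
import Literature.AnabelianGeometry.AbsoluteAnabelian.MLFGaloisNoAbelianNormalTFG
import Literature.AnabelianGeometry.AbsoluteAnabelian.AbsTopIProp410GraphSurjectivityPrelims
import Literature.AnabelianGeometry.EtaleTheta.Discharge.Sec2CompletionIndex
import Literature.IUT.HodgeArakelov.ThetaSettingDeltaCharacteristicAtModelTateDischarge
import HarnessLib

/-!
# [EtTh] Cor. 2.18 (i)/2.19 (iii): an admissible automorphism of `Π^tp_X̲̲` is Δ-STABLE — from slimness + elasticity of `G_K`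
# (row «COR219III-M1b-EVEN (β)», file 3: the residual `aug (γ b̂) = 1` of files 1–2 discharged; proof-only, generic)

S. Mochizuki, *The Étale Theta Function and its Frobenioid-theoretic Manifestations* [EtTh], Publ. RIMS **45** (2009), §2
Cor. 2.18 (i) p. 60 / Cor. 2.19 (iii) p. 64 [cite: MochizukiEtTh2009, Cor 2.19 (iii) p.64]; *Topics in Absolute Anabelian Geometry I*
[AbsTopI] Thm 1.7 (ii) p. 14 (`G_k` elastic) [cite: MochizukiAbsTopI2012, Thm 1.7 (ii) p.14]; *The local pro-p anabelian geometry of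
curves* [pGC] Lem. 15.8 p. 80 (`G_K` slim) [cite: MochizukiLocAn1999, Lem 15.8 p.80].  Cell `abc-iut`, K-L6 row «COR219III-M1b-EVEN (β)»
(abc-iut-L6-lead gen 7/8), seat abc-iut-w5-d187 (gen 8).  PROOF-ONLY: no definition, no instance, no notation, no new named fact;
consumed BY NAME — abc-iut-w5-d204's `eq_bot_of_isNilpotent_of_normal_subgroupOf_of_tfg` (`MLFGaloisNoAbelianNormalTFG`, p491815:
no non-trivial tfg closed nilpotent subgroup of `G_K` normal in an open subgroup), abc-iut-f-142's `toTheta_comm_mem_DeltaTheta`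
(`Sec2Cor219iiiHeartPrelims`), abc-iut-L2-t1's root axioms (`ker_thetaToEll_central`, `range_aug`, `ker_toTheta_le_deltaTemp`).

WHAT IS SHOWN (any §1 setting `D`, any `E`, any `X̲̲`-choice `C`, any cyclotome tower — the tower only fixes the carrier `PiX = C.Huu`).
**`aug_apply_eq_one_of_map_ker_toTheta_eq`** — let `γ` be a bi-continuous automorphism of `Π^tp_X̲̲` stabilising
`Ker(Π^tp_X̲̲ → (Π^tp_X)^Θ)` (clause (4) of Cor. 2.18 (i), the `hK` conjunct of abc-iut-C-hgal-2's `cor219_iii_of_hearts`), and suppose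
the geometric subgroup `Δ_X̲̲ := Π^tp_X̲̲ ∩ Δ^tp_X` is topologically finitely generated.  THEN `γ(Δ_X̲̲) ⊆ Δ_X̲̲`: `aug (γ g) = 1` for every
`g ∈ Π^tp_X̲̲` with `aug g = 1`.  PROOF.  `φ := aug ∘ γ` on `Δ_X̲̲` kills `Ker θ|_{Π^tp_X̲̲}` (clause (4) and `Ker θ ⊆ Δ^tp_X`), and
`⁅⁅δ₁,δ₂⁆,δ₃⁆ ∈ Ker θ` for geometric `δᵢ` (`θ`-commutators of geometric elements lie in `Δ_Θ`, which is central under `θ(Δ^tp_X)`), so the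
image `N := φ(Δ_X̲̲) ⊆ G_K` satisfies the class-2 law `⁅⁅a,b⁆,c⁆ = 1`; it is normalised by `G_K = aug(Π^tp_X̲̲)` (`Δ_X̲̲ ⊴ Π^tp_X̲̲`) and
topologically finitely generated; its closure `A` keeps all three properties (continuity), is closed, hence NILPOTENT, tfg, closed and
normal in the OPEN subgroup `G_K ⊆ G_{ℚ_p}` — so `A = ⊥` by slimness + elasticity (abc-iut-w5-d204), i.e. `φ = 1`.
COROLLARY SHAPE for files 1–2: the hypothesis `aug (γ b̂) = 1` of `isSquare_transport_discrepancy_of_aug_apply_eq_one` /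
`heart_of_isSquare_of_aug_apply_eq_one` holds for EVERY admissible `γ` (clause (4) included) once `Δ_X̲̲` is tfg; also
`isTopologicallyFinitelyGenerated_deltaUU_of_deltaTemp` — `Δ_X̲̲` is tfg as soon as `Δ^tp_X` is (`[Δ^tp_X : Δ_X̲̲] = l²`); §5 at the Tate
model `modelχq p i j` (abc-iut-w4-d044's `isTopologicallyFinitelyGenerated_deltaTempχq`): **`aug_apply_eq_one_modelχq_of_map_ker_toTheta_eq`**
— EVERY admissible `γ` with clause (4) is Δ-stable, no hypothesis.
RESIDUAL: none at the Tate model; generic settings carry «`Δ^tp_X` topologically finitely generated» ([AbsTopI] §0 parameter) as the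
displayed hypothesis.
HONEST FRAMING: classical profinite group theory over OUR typed §1 interface; nothing of [EtTh] (refereed) is asserted or denied for a
curve; no side is taken on [IUTchIII] Cor. 3.12; typed ≠ proved; nothing here asserts abc proved or refuted.
-/

noncomputable section

namespace Literature.AnabelianGeometry.EtaleTheta

open Literature.AnabelianGeometry.SemiGraphs Literature.AnabelianGeometry.AbsoluteAnabelian _root_.Topology
open scoped commutatorElement

namespace ThetaSetting.EtaleThetaData.DoubleUnderline

variable {p : ℕ} [Fact p.Prime] {D : ThetaSetting p} {E : D.EtaleThetaData} {l : ℕ}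
  (C : E.DoubleUnderline l)

/-! ## §1 The class-2 law for `aug ∘ γ` on `Δ_X̲̲` -/

/-- `θ⁅⁅δ₁, δ₂⁆, δ₃⁆ = 1` for geometric `δ₁, δ₂, δ₃ ∈ Π^tp_X`: `θ⁅δ₁, δ₂⁆ ∈ Δ_Θ` (abc-iut-f-142's `toTheta_comm_mem_DeltaTheta`) is
central under `θ(Δ^tp_X)` (root axiom `ker_thetaToEll_central`). [cite: MochizukiEtTh2009, §1 p.12] -/
theorem toTheta_commutator_commutator_eq_one {x y z : D.PiTemp} (hx : D.aug.toMonoidHom x = 1)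
    (hy : D.aug.toMonoidHom y = 1) (hz : D.aug.toMonoidHom z = 1) : D.toTheta ⁅⁅x, y⁆, z⁆ = 1 := by
  have hmem : D.toTheta ⁅x, y⁆ ∈ D.DeltaTheta := by
    rw [commutatorElement_def]
    exact D.toTheta_comm_mem_DeltaTheta hx hy
  have hcen := D.ker_thetaToEll_central _ hmem (D.toTheta z) ⟨z, (MonoidHom.mem_ker).2 hz, rfl⟩
  rw [map_commutatorElement, commutatorElement_eq_one_iff_mul_comm, hcen]

/-- **Clause (4) makes `aug ∘ γ` kill `Ker θ|_{Π^tp_X̲̲}`**: if `γ` stabilises `Ker(Π^tp_X̲̲ → (Π^tp_X)^Θ)` then `aug (γ k) = 1` for every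
`k ∈ Π^tp_X̲̲` with `θ k = 1` (`Ker θ ⊆ Δ^tp_X`, abc-iut-L2-t1's `ker_toTheta_le_deltaTemp`). [cite: MochizukiEtTh2009, Cor 2.18 (i) p.60] -/
theorem aug_apply_eq_one_of_toTheta_eq_one (γ : C.Huu ≃ₜ* C.Huu)
    (hK : (D.toTheta.comp C.Huu.subtype).ker.map γ.toMulEquiv.toMonoidHom = (D.toTheta.comp C.Huu.subtype).ker)
    {k : C.Huu} (hk : D.toTheta (k : D.PiTemp) = 1) : D.aug.toMonoidHom ((γ k : C.Huu) : D.PiTemp) = 1 := by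
  have hkK : k ∈ (D.toTheta.comp C.Huu.subtype).ker := by
    rw [MonoidHom.mem_ker, MonoidHom.coe_comp, Function.comp_apply, Subgroup.coe_subtype, hk]
  have hγk : γ k ∈ (D.toTheta.comp C.Huu.subtype).ker := by
    have : γ k ∈ (D.toTheta.comp C.Huu.subtype).ker.map γ.toMulEquiv.toMonoidHom := ⟨k, hkK, rfl⟩
    rwa [hK] at this
  rw [MonoidHom.mem_ker, MonoidHom.coe_comp, Function.comp_apply, Subgroup.coe_subtype] at hγk
  have hΔ : ((γ k : C.Huu) : D.PiTemp) ∈ D.DeltaTemp := D.ker_toTheta_le_deltaTemp ((MonoidHom.mem_ker).2 hγk)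
  exact (MonoidHom.mem_ker).1 hΔ

/-- **The class-2 law for `φ := aug ∘ γ` on `Δ_X̲̲`**: `⁅⁅φ δ₁, φ δ₂⁆, φ δ₃⁆ = 1` for geometric `δᵢ ∈ Π^tp_X̲̲`, `γ` stabilising
`Ker θ|_{Π^tp_X̲̲}`. [cite: MochizukiEtTh2009, Cor 2.18 (i) p.60] -/
theorem commutator_commutator_aug_apply_eq_one (γ : C.Huu ≃ₜ* C.Huu)
    (hK : (D.toTheta.comp C.Huu.subtype).ker.map γ.toMulEquiv.toMonoidHom = (D.toTheta.comp C.Huu.subtype).ker)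
    {x y z : C.Huu} (hx : D.aug.toMonoidHom (x : D.PiTemp) = 1) (hy : D.aug.toMonoidHom (y : D.PiTemp) = 1)
    (hz : D.aug.toMonoidHom (z : D.PiTemp) = 1) :
    ⁅⁅D.aug.toMonoidHom ((γ x : C.Huu) : D.PiTemp), D.aug.toMonoidHom ((γ y : C.Huu) : D.PiTemp)⁆,
      D.aug.toMonoidHom ((γ z : C.Huu) : D.PiTemp)⁆ = 1 := by
  have hcoe : ∀ u v : C.Huu, ((⁅u, v⁆ : C.Huu) : D.PiTemp) = ⁅(u : D.PiTemp), (v : D.PiTemp)⁆ := fun u v => by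
    simp only [commutatorElement_def, Subgroup.coe_mul, Subgroup.coe_inv]
  have h := C.aug_apply_eq_one_of_toTheta_eq_one γ hK (k := ⁅⁅x, y⁆, z⁆)
    (by rw [hcoe, hcoe]; exact toTheta_commutator_commutator_eq_one hx hy hz)
  rwa [map_commutatorElement, map_commutatorElement, hcoe, hcoe, map_commutatorElement, map_commutatorElement] at h

/-! ## §2 A subgroup of a Hausdorff topological group satisfying the class-2 law has nilpotent closure -/

/-- If every triple of elements of a subgroup `N` of a Hausdorff topological group satisfies `⁅⁅a,b⁆,c⁆ = 1`, so does every triple of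
elements of its closure (three continuity passes). [cite: NeukirchSchmidtWingberg2008, Ch. VII §5] -/
theorem commutator_commutator_eq_one_of_mem_topologicalClosure {G : Type*} [Group G] [TopologicalSpace G]
    [IsTopologicalGroup G] [T2Space G] (N : Subgroup G) (hN : ∀ a ∈ N, ∀ b ∈ N, ∀ c ∈ N, ⁅⁅a, b⁆, c⁆ = (1 : G)) :
    ∀ a ∈ N.topologicalClosure, ∀ b ∈ N.topologicalClosure, ∀ c ∈ N.topologicalClosure, ⁅⁅a, b⁆, c⁆ = (1 : G) := by
  -- the closed set cut out by a continuous equation contains the closure of any set it contains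
  have key : ∀ (f : G → G), Continuous f → (∀ a ∈ N, f a = 1) → ∀ a ∈ N.topologicalClosure, f a = 1 := by
    intro f hf h a ha
    have hsub : (N : Set G) ⊆ f ⁻¹' {1} := fun x hx => h x hx
    have hcl : IsClosed (f ⁻¹' {1}) := isClosed_singleton.preimage hf
    exact hcl.closure_subset_iff.mpr hsub ha
  have hcont : ∀ b c : G, Continuous fun a : G => ⁅⁅a, b⁆, c⁆ := fun b c => by
    simp only [commutatorElement_def]
    fun_prop
  have hcont' : ∀ a c : G, Continuous fun b : G => ⁅⁅a, b⁆, c⁆ := fun a c => by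
    simp only [commutatorElement_def]
    fun_prop
  have hcont'' : ∀ a b : G, Continuous fun c : G => ⁅⁅a, b⁆, c⁆ := fun a b => by
    simp only [commutatorElement_def]
    fun_prop
  -- pass 1: `a` in the closure, `b, c ∈ N`
  have h1 : ∀ a ∈ N.topologicalClosure, ∀ b ∈ N, ∀ c ∈ N, ⁅⁅a, b⁆, c⁆ = (1 : G) :=
    fun a ha b hb c hc => key (fun a => ⁅⁅a, b⁆, c⁆) (hcont b c) (fun a ha => hN a ha b hb c hc) a ha
  -- pass 2: `b` in the closure
  have h2 : ∀ a ∈ N.topologicalClosure, ∀ b ∈ N.topologicalClosure, ∀ c ∈ N, ⁅⁅a, b⁆, c⁆ = (1 : G) :=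
    fun a ha b hb c hc => key (fun b => ⁅⁅a, b⁆, c⁆) (hcont' a c) (fun b hb => h1 a ha b hb c hc) b hb
  -- pass 3: `c` in the closure
  exact fun a ha b hb c hc => key (fun c => ⁅⁅a, b⁆, c⁆) (hcont'' a b) (fun c hc => h2 a ha b hb c hc) c hc

/-- A group all of whose triples satisfy `⁅⁅a,b⁆,c⁆ = 1` is nilpotent (of class `≤ 2`: `⁅⊤,⊤⁆` is central, so the lower central series
dies at step `2`). [cite: NeukirchSchmidtWingberg2008, Ch. VII §5] -/
theorem isNilpotent_of_commutator_commutator_eq_one {G : Type*} [Group G] (h : ∀ a b c : G, ⁅⁅a, b⁆, c⁆ = 1) :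
    Group.IsNilpotent G := by
  rw [Subgroup.nilpotent_iff_lowerCentralSeries]
  refine ⟨2, Subgroup.lowerCentralSeries_succ_eq_bot ⊤ ?_⟩
  rw [Subgroup.lowerCentralSeries_succ, Subgroup.lowerCentralSeries_zero, Subgroup.commutator_def, Subgroup.closure_le]
  rintro _ ⟨a, -, b, -, rfl⟩
  exact Subgroup.mem_center_iff.mpr fun c => by
    have := h a b c
    rw [commutatorElement_eq_one_iff_mul_comm] at this
    exact this.symm

/-! ## §3 Δ-stability of admissible automorphisms -/

/-- **An admissible automorphism of `Π^tp_X̲̲` is Δ-STABLE** (any §1 setting, any `X̲̲`-choice): if the bi-continuous automorphism `γ` of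
`Π^tp_X̲̲ = C.Huu` stabilises `Ker(Π^tp_X̲̲ → (Π^tp_X)^Θ)` (clause (4) of [EtTh] Cor. 2.18 (i)) and `Δ_X̲̲ = Π^tp_X̲̲ ∩ Δ^tp_X` is topologically
finitely generated, then `aug (γ g) = 1` for every `g ∈ Π^tp_X̲̲` with `aug g = 1`.  The closure of `aug(γ(Δ_X̲̲))` is a tfg closed
NILPOTENT subgroup of `G_{ℚ_p}` normal in the open subgroup `G_K = aug(Π^tp_X̲̲)`, hence trivial by abc-iut-w5-d204's
`eq_bot_of_isNilpotent_of_normal_subgroupOf_of_tfg` (slimness [pGC] Lem. 15.8 + elasticity [AbsTopI] Thm 1.7 (ii)).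
[cite: MochizukiAbsTopI2012, Thm 1.7 (ii) p.14] -/
theorem aug_apply_eq_one_of_map_ker_toTheta_eq (γ : C.Huu ≃ₜ* C.Huu)
    (hK : (D.toTheta.comp C.Huu.subtype).ker.map γ.toMulEquiv.toMonoidHom = (D.toTheta.comp C.Huu.subtype).ker)
    (hfg : IsTopologicallyFinitelyGenerated ↥(D.DeltaTemp.subgroupOf C.Huu))
    (g : C.Huu) (hg : D.aug.toMonoidHom (g : D.PiTemp) = 1) : D.aug.toMonoidHom ((γ g : C.Huu) : D.PiTemp) = 1 := by
  classical
  haveI := D.finiteDimensional_K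
  -- the continuous homomorphism `φ := aug ∘ γ` on `Π^tp_X̲̲` and the image `N` of `Δ_X̲̲`
  set Δ : Subgroup C.Huu := D.DeltaTemp.subgroupOf C.Huu with hΔdef
  let φ : C.Huu →ₜ* GQp p :=
    { toMonoidHom := (D.aug.toMonoidHom.comp C.Huu.subtype).comp γ.toMulEquiv.toMonoidHom
      continuous_toFun := D.aug.continuous.comp (continuous_subtype_val.comp γ.continuous) }
  have hφ : ∀ x : C.Huu, φ x = D.aug.toMonoidHom ((γ x : C.Huu) : D.PiTemp) := fun _ => rfl
  set N : Subgroup (GQp p) := Δ.map φ.toMonoidHom with hNdef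
  set A : Subgroup (GQp p) := N.topologicalClosure with hAdef
  have hgΔ : g ∈ Δ := by rw [hΔdef, Subgroup.mem_subgroupOf]; exact (MonoidHom.mem_ker).2 hg
  -- it suffices that `A = ⊥`
  suffices hA : A = ⊥ by
    have hmem : φ g ∈ A := Subgroup.le_topologicalClosure _ ⟨g, hgΔ, rfl⟩
    rw [hA, Subgroup.mem_bot] at hmem
    rwa [hφ] at hmem
  -- `G_K` is open and contains `N`, `A`
  have hGKo : IsOpen (D.GK : Set (GQp p)) := D.K.fixingSubgroup_isOpen
  have hφGK : ∀ x : C.Huu, φ x ∈ D.GK := fun x => by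
    rw [hφ]
    have : D.aug.toMonoidHom ((γ x : C.Huu) : D.PiTemp) ∈ D.aug.toMonoidHom.range := ⟨_, rfl⟩
    rwa [D.range_aug] at this
  have hNGK : N ≤ D.GK := by
    rintro _ ⟨x, -, rfl⟩; exact hφGK x
  have hAGK : A ≤ D.GK :=
    N.topologicalClosure_minimal hNGK (Subgroup.isClosed_of_isOpen _ hGKo)
  -- `N` is normalised by `G_K = aug(Π^tp_X̲̲)`
  have hNconj : ∀ h ∈ D.GK, ∀ n ∈ N, h * n * h⁻¹ ∈ N := by
    intro h hh n hn
    obtain ⟨δ, hδ, rfl⟩ := hn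
    have hδ' : δ ∈ Δ := hδ
    -- lift `h` to `x ∈ Π^tp_X̲̲` (`aug(Π^tp_Ÿ̲̲) = G_K`), then through `γ`
    have hh' : h ∈ (D.GtpYdd ⊓ C.Huu).map D.aug.toMonoidHom := by rw [C.map_aug_Ydduu]; exact hh
    obtain ⟨x, hx, rfl⟩ := hh'
    -- `x ∈ Huu`; write `x = γ y` with `y := γ⁻¹ x`
    set y : C.Huu := γ.symm ⟨x, (Subgroup.mem_inf.mp hx).2⟩ with hydef
    have hγy : ((γ y : C.Huu) : D.PiTemp) = x := by
      rw [hydef, ContinuousMulEquiv.apply_symm_apply]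
    have hmemΔ : y * δ * y⁻¹ ∈ Δ := by
      rw [hΔdef, Subgroup.mem_subgroupOf] at hδ' ⊢
      rw [Subgroup.coe_mul, Subgroup.coe_mul, Subgroup.coe_inv]
      exact (MonoidHom.normal_ker D.aug.toMonoidHom).conj_mem _ hδ' _
    refine ⟨y * δ * y⁻¹, hmemΔ, ?_⟩
    change φ (y * δ * y⁻¹) = D.aug.toMonoidHom x * φ δ * (D.aug.toMonoidHom x)⁻¹
    rw [map_mul, map_mul, map_inv, hφ y, hγy]
  have hAconj : ∀ h ∈ D.GK, ∀ a ∈ A, h * a * h⁻¹ ∈ A := by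
    intro h hh a ha
    have hcont : Continuous fun t : GQp p => h * t * h⁻¹ := by fun_prop
    have hmaps : Set.MapsTo (fun t : GQp p => h * t * h⁻¹) (N : Set (GQp p)) (N : Set (GQp p)) :=
      fun t ht => hNconj h hh t ht
    have ha' : a ∈ closure (N : Set (GQp p)) := ha
    have := map_mem_closure (f := fun t : GQp p => h * t * h⁻¹) hcont ha' hmaps
    exact this
  have hAn : (A.subgroupOf D.GK).Normal := by
    refine ⟨fun a ha h => ?_⟩
    rw [Subgroup.mem_subgroupOf] at ha ⊢
    rw [Subgroup.coe_mul, Subgroup.coe_mul, Subgroup.coe_inv]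
    exact hAconj _ h.2 _ ha
  -- `A` is topologically finitely generated
  let φΔ : Δ →ₜ* A :=
    { toMonoidHom :=
        { toFun := fun x => ⟨φ (x : C.Huu), Subgroup.le_topologicalClosure _ ⟨(x : C.Huu), x.2, rfl⟩⟩
          map_one' := Subtype.ext (by simp)
          map_mul' := fun x y => Subtype.ext (by simp) }
      continuous_toFun := (φ.continuous.comp continuous_subtype_val).subtype_mk _ }
  have hdense : DenseRange φΔ := by
    rw [DenseRange, Subtype.dense_iff]
    intro a ha
    have hsub : (N : Set (GQp p)) ⊆ Subtype.val '' Set.range φΔ := by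
      rintro _ ⟨x, hx, rfl⟩
      exact ⟨⟨φ x, Subgroup.le_topologicalClosure _ ⟨x, hx, rfl⟩⟩, ⟨⟨x, hx⟩, rfl⟩, rfl⟩
    exact closure_mono hsub ha
  have hAfg : IsTopologicallyFinitelyGenerated A := IsTopologicallyFinitelyGenerated.of_denseRange φΔ hdense hfg
  -- `A` satisfies the class-2 law, hence is nilpotent
  have hNlaw : ∀ a ∈ N, ∀ b ∈ N, ∀ c ∈ N, ⁅⁅a, b⁆, c⁆ = (1 : GQp p) := by
    rintro _ ⟨x, hx, rfl⟩ _ ⟨y, hy, rfl⟩ _ ⟨z, hz, rfl⟩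
    have hx' : x ∈ Δ := hx
    have hy' : y ∈ Δ := hy
    have hz' : z ∈ Δ := hz
    rw [hΔdef, Subgroup.mem_subgroupOf] at hx' hy' hz'
    exact C.commutator_commutator_aug_apply_eq_one γ hK ((MonoidHom.mem_ker).1 hx') ((MonoidHom.mem_ker).1 hy')
      ((MonoidHom.mem_ker).1 hz')
  have hAlaw := commutator_commutator_eq_one_of_mem_topologicalClosure N hNlaw
  have hcoeA : ∀ u v : A, ((⁅u, v⁆ : A) : GQp p) = ⁅(u : GQp p), (v : GQp p)⁆ := fun u v => by
    simp only [commutatorElement_def, Subgroup.coe_mul, Subgroup.coe_inv]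
  have hAnil : Group.IsNilpotent A :=
    isNilpotent_of_commutator_commutator_eq_one fun a b c => Subtype.ext (by
      rw [hcoeA, hcoeA, OneMemClass.coe_one]
      exact hAlaw _ a.2 _ b.2 _ c.2)
  have hAc : IsClosed (A : Set (GQp p)) := Subgroup.isClosed_topologicalClosure _
  -- slimness + elasticity of `G_K ⊆ G_{ℚ_p}` (abc-iut-w5-d204): `A = ⊥`
  exact eq_bot_of_isNilpotent_of_normal_subgroupOf_of_tfg p ℚ_[p] D.GK A hGKo hAGK hAn hAc hAfg hAnil


/-! ## §4 `Δ_X̲̲` is tfg as soon as `Δ^tp_X` is (finite index `l²`) -/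

/-- **`Δ_X̲̲ = Π^tp_X̲̲ ∩ Δ^tp_X` is topologically finitely generated whenever `Δ^tp_X` is**: it is an OPEN subgroup of FINITE index
`l²` of `Δ^tp_X` (abc-iut-w5-d233's `index_Huu_subgroupOf_deltaTemp`, `isOpen_Huu`), so abc-iut-L4's Schreier lemma
`IsTopologicallyFinitelyGenerated.subgroup_isOpen_of_finiteIndex` applies; the two subtype carriers `(Huu ∩ Δ ⊆ Δ)` and `(Δ ∩ Huu ⊆ Huu)`
are identified by the evident bi-continuous isomorphism. [cite: MochizukiAbsTopI2012, §0 p.8] -/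
theorem isTopologicallyFinitelyGenerated_deltaUU_of_deltaTemp (hΔ : IsTopologicallyFinitelyGenerated ↥D.DeltaTemp) :
    IsTopologicallyFinitelyGenerated ↥(D.DeltaTemp.subgroupOf C.Huu) := by
  haveI : (C.Huu.subgroupOf D.DeltaTemp).FiniteIndex :=
    ⟨by rw [C.index_Huu_subgroupOf_deltaTemp]; exact pow_ne_zero 2 C.l_ne_zero⟩
  have hopen : IsOpen ((C.Huu.subgroupOf D.DeltaTemp : Subgroup D.DeltaTemp) : Set D.DeltaTemp) :=
    C.isOpen_Huu.preimage continuous_subtype_val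
  have h1 : IsTopologicallyFinitelyGenerated ↥(C.Huu.subgroupOf D.DeltaTemp) :=
    hΔ.subgroup_isOpen_of_finiteIndex _ hopen
  -- the two carriers `{x ∈ Δ | x ∈ Huu}` and `{x ∈ Huu | x ∈ Δ}`
  let e : ↥(C.Huu.subgroupOf D.DeltaTemp) ≃ₜ* ↥(D.DeltaTemp.subgroupOf C.Huu) :=
    { toFun := fun x => ⟨⟨(x : D.DeltaTemp), x.2⟩, (x : D.DeltaTemp).2⟩
      invFun := fun x => ⟨⟨(x : C.Huu), x.2⟩, (x : C.Huu).2⟩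
      left_inv := fun _ => rfl
      right_inv := fun _ => rfl
      map_mul' := fun _ _ => rfl
      continuous_toFun := ((continuous_subtype_val.comp continuous_subtype_val).subtype_mk _).subtype_mk _
      continuous_invFun := ((continuous_subtype_val.comp continuous_subtype_val).subtype_mk _).subtype_mk _ }
  exact h1.of_continuousMulEquiv e

/-- **Δ-stability of admissible automorphisms, `Δ^tp_X`-tfg form**: for a §1 setting whose `Δ^tp_X` is topologically finitely
generated (the [AbsTopI] §0 parameter, witnessed at the tree's models), every bi-continuous automorphism of `Π^tp_X̲̲` stabilising
`Ker(Π^tp_X̲̲ → (Π^tp_X)^Θ)` maps geometric elements to geometric elements. [cite: MochizukiAbsTopI2012, Thm 1.7 (ii) p.14] -/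
theorem aug_apply_eq_one_of_map_ker_toTheta_eq_of_deltaTemp (hΔ : IsTopologicallyFinitelyGenerated ↥D.DeltaTemp)
    (γ : C.Huu ≃ₜ* C.Huu)
    (hK : (D.toTheta.comp C.Huu.subtype).ker.map γ.toMulEquiv.toMonoidHom = (D.toTheta.comp C.Huu.subtype).ker)
    (g : C.Huu) (hg : D.aug.toMonoidHom (g : D.PiTemp) = 1) : D.aug.toMonoidHom ((γ g : C.Huu) : D.PiTemp) = 1 :=
  C.aug_apply_eq_one_of_map_ker_toTheta_eq γ hK (C.isTopologicallyFinitelyGenerated_deltaUU_of_deltaTemp hΔ) g hg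

end ThetaSetting.EtaleThetaData.DoubleUnderline

/-! ## §5 At the Tate model `modelχq p i j`: `Δ^tp_X ≃ Γ = F̂₂ ×_Ẑ ℤ` is tfg, so EVERY admissible `γ` is Δ-stable -/

namespace SettingModel

variable (p : ℕ) [Fact p.Prime] (i j : ℤ)

variable (hj : Even j)

/-- `Δ^tp_X` of the stage-2 theta setting `ThetaSetting.modelχq p i j` is topologically finitely generated — its tempered-curve layer
is `curveχq p i j`, for which this is abc-iut-w4-d044's `isTopologicallyFinitelyGenerated_deltaTempχq`
(`ThetaSettingDeltaCharacteristicAtModelTateDischarge`, from abc-iut-w5-d233's `isTopologicallyFinitelyGenerated_gfp`), cited BY NAME.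
[cite: MochizukiSemiAnbd2006, Ex 3.10 p.43] -/
theorem isTopologicallyFinitelyGenerated_deltaTemp_modelχq :
    IsTopologicallyFinitelyGenerated (ThetaSetting.modelχq p i j hj).DeltaTemp :=
  isTopologicallyFinitelyGenerated_deltaTempχq p i j

/-- **At the Tate model EVERY admissible `γ` is Δ-stable** (every `E`, every `X̲̲`-choice `C`): a bi-continuous automorphism of
`Π^tp_X̲̲` stabilising `Ker(Π^tp_X̲̲ → (Π^tp_X)^Θ)` (clause (4) of [EtTh] Cor. 2.18 (i)) maps `Δ_X̲̲` into itself — the (H1)/hextΔ-class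
clause «`aug (γ g) = 1`» of the K-L6 record is a THEOREM here, not an input. [cite: MochizukiAbsTopI2012, Thm 1.7 (ii) p.14] -/
theorem aug_apply_eq_one_modelχq_of_map_ker_toTheta_eq {E : (ThetaSetting.modelχq p i j hj).EtaleThetaData} {l : ℕ}
    (C : E.DoubleUnderline l) (γ : C.Huu ≃ₜ* C.Huu)
    (hK : ((ThetaSetting.modelχq p i j hj).toTheta.comp C.Huu.subtype).ker.map γ.toMulEquiv.toMonoidHom =
      ((ThetaSetting.modelχq p i j hj).toTheta.comp C.Huu.subtype).ker)
    (g : C.Huu) (hg : (ThetaSetting.modelχq p i j hj).aug.toMonoidHom (g : (ThetaSetting.modelχq p i j hj).PiTemp) = 1) :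
    (ThetaSetting.modelχq p i j hj).aug.toMonoidHom ((γ g : C.Huu) : (ThetaSetting.modelχq p i j hj).PiTemp) = 1 :=
  C.aug_apply_eq_one_of_map_ker_toTheta_eq_of_deltaTemp (isTopologicallyFinitelyGenerated_deltaTemp_modelχq p i j hj) γ hK g hg

end SettingModel

end Literature.AnabelianGeometry.EtaleTheta

end
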